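import Summits.Ventures.HodgeRepro2.T5InertResidueInvolution

/-!
# The trace lift from the non-triviality of the residue involution
(cell pub-hodge-repro2, seat p3)

Tier-5 N3 support. Files 195–203 count `deg Tₙ = (q³ + 1) q^{4n−3}` modulo two hypotheses on the inert-place
package: the TRACE LIFT `htr : ∃ e ∈ R, e + ē = 1` and the NON-TRIVIALITY `hnt` of the residue involution
`σ̄`. This file derives the first from the second, so that the whole count rests on `hnt` alone:

* `fixedSubfield` — the fixed field `𝔽₀ = {t : σ̄ t = t}` as a subfield of `𝔽`; **`two_le_finrank`** — `[𝔽 : 𝔽₀] ≥ 2`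
  when `σ̄ ≠ 1` (if `[𝔽 : 𝔽₀] ≤ 1` every element is an `𝔽₀`-multiple of one vector, which lies in `𝔽₀` as `1`
  does), hence `#𝔽₀² ≤ #𝔽`;
* `card_ker_mul_card_range` — `#ker(t ↦ t + σ̄ t) · #range = #𝔽`, `card_ker_eq_card_fixed` — `#ker = #𝔽₀`
  (the `t₀`-trick of file 202 on the kernel, no trace lift needed), and `range ⊆ 𝔽₀`: hence
  **`range_tracePlus_eq_fixed`** — THE TRACE `t ↦ t + σ̄ t` IS ONTO `𝔽₀` (`#range ≥ #𝔽 / #𝔽₀ ≥ #𝔽₀`);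
* **`exists_trace_lift`** — `∃ e ∈ R, e + ē = 1`: a lift `x` of a class of trace `1` has `x + x̄ = 1 + ϖ y`
  with `y` star-fixed, a unit `v = 1 + ϖ y`, and `e := x / v` works.

Consequence: every theorem of files 196–203 holds with `htr` replaced by `exists_trace_lift hnt`.

Mathlib + this seat's file 202 and its imports; no display; no device.
§8(d): uses an L-value-free non-vanishing device: NO.
-/

namespace Summit.Ventures.HodgeRepro2.T5InertTraceLift

open Summit.Ventures.HodgeRepro2.T5InertUnipotentResidue Summit.Ventures.HodgeRepro2.T5InertResidueInvolution
  Summit.Ventures.HodgeRepro2.T5InertTopCoefficientMatrix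

section TraceLift

variable {R E : Type*} [CommRing R] [IsDomain R] [IsDiscreteValuationRing R] [Field E] [StarRing E]
  [Algebra R E] [IsFractionRing R E] [Finite (IsLocalRing.ResidueField R)]
  (hstar : ∀ x : E, IsLocalization.IsInteger R x → IsLocalization.IsInteger R (star x))
  {ϖ : R} (hϖ : Irreducible ϖ) (hs : star (algebraMap R E ϖ) = algebraMap R E ϖ)

/-! ### The fixed field as a subfield and its index -/

/-- **The fixed field `𝔽₀ = {t : σ̄ t = t}`** of the residue involution, as a subfield of `𝔽`. -/
def fixedSubfield : Subfield (IsLocalRing.ResidueField R) where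
  carrier := fixedSet hstar hϖ hs
  mul_mem' := by
    intro a b ha hb
    change residueStar hstar hϖ hs a = a at ha
    change residueStar hstar hϖ hs b = b at hb
    show residueStar hstar hϖ hs (a * b) = a * b
    rw [map_mul, ha, hb]
  one_mem' := by
    show residueStar hstar hϖ hs 1 = 1
    rw [map_one]
  add_mem' := by
    intro a b ha hb
    change residueStar hstar hϖ hs a = a at ha
    change residueStar hstar hϖ hs b = b at hb
    show residueStar hstar hϖ hs (a + b) = a + b
    rw [map_add, ha, hb]
  zero_mem' := by
    show residueStar hstar hϖ hs 0 = 0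
    rw [map_zero]
  neg_mem' := by
    intro a ha
    change residueStar hstar hϖ hs a = a at ha
    show residueStar hstar hϖ hs (-a) = -a
    rw [map_neg, ha]
  inv_mem' := by
    intro a ha
    change residueStar hstar hϖ hs a = a at ha
    show residueStar hstar hϖ hs a⁻¹ = a⁻¹
    rw [map_inv₀, ha]

omit [Finite (IsLocalRing.ResidueField R)] in
/-- Membership in the fixed subfield. -/
theorem mem_fixedSubfield_iff (t : IsLocalRing.ResidueField R) :
    t ∈ fixedSubfield hstar hϖ hs ↔ residueStar hstar hϖ hs t = t := Iff.rfl

/-- **`[𝔽 : 𝔽₀] ≥ 2`** when the residue involution is non-trivial. -/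
theorem two_le_finrank (hnt : ∃ t : IsLocalRing.ResidueField R, residueStar hstar hϖ hs t ≠ t) :
    2 ≤ Module.finrank (fixedSubfield hstar hϖ hs) (IsLocalRing.ResidueField R) := by
  haveI : Module.Finite (fixedSubfield hstar hϖ hs) (IsLocalRing.ResidueField R) := Module.Finite.of_finite
  by_contra h
  obtain ⟨v, hv⟩ := finrank_le_one_iff.1 (Nat.lt_succ_iff.1 (not_le.1 h))
  obtain ⟨t, ht⟩ := hnt
  -- `v ∈ 𝔽₀`: `1 = c • v` with `c ∈ 𝔽₀`, so `v = c⁻¹`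
  obtain ⟨c, hc⟩ := hv 1
  rw [Subfield.smul_def, smul_eq_mul] at hc
  have hvmem : v ∈ fixedSubfield hstar hϖ hs := by
    rw [eq_inv_of_mul_eq_one_right hc]
    exact Subfield.inv_mem _ c.2
  -- then every `t = c' • v` lies in `𝔽₀`
  obtain ⟨c', hc'⟩ := hv t
  apply ht
  rw [← hc', Subfield.smul_def, smul_eq_mul]
  exact Subfield.mul_mem _ c'.2 hvmem

/-- **`#𝔽₀² ≤ #𝔽`** when the residue involution is non-trivial. -/
theorem card_fixed_sq_le (hnt : ∃ t : IsLocalRing.ResidueField R, residueStar hstar hϖ hs t ≠ t) :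
    Nat.card (fixedSet hstar hϖ hs) ^ 2 ≤ Nat.card (IsLocalRing.ResidueField R) := by
  classical
  haveI : Fintype (IsLocalRing.ResidueField R) := Fintype.ofFinite _
  haveI : Fintype (fixedSubfield hstar hϖ hs) := Fintype.ofFinite _
  have h := Module.card_eq_pow_finrank (K := fixedSubfield hstar hϖ hs) (V := IsLocalRing.ResidueField R)
  have hcard : Nat.card (fixedSet hstar hϖ hs) = Fintype.card (fixedSubfield hstar hϖ hs) := by
    rw [← Nat.card_eq_fintype_card]
    rfl
  rw [hcard, Nat.card_eq_fintype_card, h]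
  exact Nat.pow_le_pow_right Fintype.card_pos (two_le_finrank hstar hϖ hs hnt)

/-! ### The trace `t ↦ t + σ̄ t` is onto the fixed field -/

omit [Finite (IsLocalRing.ResidueField R)] in
/-- `#ker · #range = #𝔽` for the additive map `t ↦ t + σ̄ t`. -/
theorem card_ker_mul_card_range :
    Nat.card (tracePlus hstar hϖ hs).ker * Nat.card (tracePlus hstar hϖ hs).range =
      Nat.card (IsLocalRing.ResidueField R) := by
  have h := AddSubgroup.card_mul_index (tracePlus hstar hϖ hs).ker
  rwa [AddSubgroup.index_ker] at h

omit [Finite (IsLocalRing.ResidueField R)] in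
/-- The range of `t ↦ t + σ̄ t` lies in the fixed field. -/
theorem range_tracePlus_subset :
    ((tracePlus hstar hϖ hs).range : Set (IsLocalRing.ResidueField R)) ⊆ fixedSet hstar hϖ hs := by
  rintro t ⟨s, rfl⟩
  show residueStar hstar hϖ hs (s + residueStar hstar hϖ hs s) = s + residueStar hstar hϖ hs s
  rw [map_add, residueStar_residueStar, add_comm]

omit [Finite (IsLocalRing.ResidueField R)] in
/-- `#ker(t ↦ t + σ̄ t) = #𝔽₀` when `σ̄ ≠ 1` (the `t₀`-trick of file 202 on the kernel). -/
theorem card_ker_eq_card_fixed (hnt : ∃ t : IsLocalRing.ResidueField R, residueStar hstar hϖ hs t ≠ t) :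
    Nat.card (tracePlus hstar hϖ hs).ker = Nat.card (fixedSet hstar hϖ hs) := by
  have hT : ((tracePlus hstar hϖ hs).ker : Set (IsLocalRing.ResidueField R)) =
      {t | residueStar hstar hϖ hs t = -t} := by
    ext t
    rw [SetLike.mem_coe, AddMonoidHom.mem_ker, tracePlus_apply, Set.mem_setOf_eq, add_eq_zero_iff_neg_eq,
      eq_comm]
  have e1 : Nat.card (tracePlus hstar hϖ hs).ker =
      Nat.card {t | residueStar hstar hϖ hs t = -t} := Nat.card_congr (Equiv.setCongr hT)
  rw [e1]
  by_cases h2 : (2 : IsLocalRing.ResidueField R) = 0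
  · have hneg : ∀ y : IsLocalRing.ResidueField R, -y = y := fun y => by
      rw [neg_eq_iff_add_eq_zero, ← two_mul, h2, zero_mul]
    have hset : {t | residueStar hstar hϖ hs t = -t} = fixedSet hstar hϖ hs := by
      ext t
      simp only [Set.mem_setOf_eq, hneg]
      exact Iff.rfl
    rw [hset]
  · obtain ⟨x, hx⟩ := hnt
    set t₀ : IsLocalRing.ResidueField R := x - residueStar hstar hϖ hs x with ht₀
    have ht₀0 : t₀ ≠ 0 := sub_ne_zero.2 (Ne.symm hx)
    have hst₀ : residueStar hstar hϖ hs t₀ = -t₀ := by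
      rw [ht₀, map_sub, residueStar_residueStar, neg_sub]
    symm
    refine Nat.card_congr
      { toFun := fun t => ⟨t * t₀, ?_⟩
        invFun := fun s => ⟨s * t₀⁻¹, ?_⟩
        left_inv := fun t => ?_
        right_inv := fun s => ?_ }
    · have ht : residueStar hstar hϖ hs t = t := t.2
      show residueStar hstar hϖ hs (t * t₀) = -(t * t₀)
      rw [map_mul, ht, hst₀, mul_neg]
    · have hs' : residueStar hstar hϖ hs s = -s := s.2
      show residueStar hstar hϖ hs (s * t₀⁻¹) = s * t₀⁻¹
      rw [map_mul, hs', map_inv₀, hst₀, neg_mul, inv_neg, mul_neg, neg_neg]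
    · apply Subtype.ext
      show (t : IsLocalRing.ResidueField R) * t₀ * t₀⁻¹ = t
      rw [mul_inv_cancel_right₀ ht₀0]
    · apply Subtype.ext
      show (s : IsLocalRing.ResidueField R) * t₀⁻¹ * t₀ = s
      rw [inv_mul_cancel_right₀ ht₀0]

/-- **The trace `t ↦ t + σ̄ t` is onto the fixed field** when `σ̄ ≠ 1`. -/
theorem range_tracePlus_eq_fixed (hnt : ∃ t : IsLocalRing.ResidueField R, residueStar hstar hϖ hs t ≠ t) :
    ((tracePlus hstar hϖ hs).range : Set (IsLocalRing.ResidueField R)) = fixedSet hstar hϖ hs := by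
  have hsub := range_tracePlus_subset hstar hϖ hs
  have hmul := card_ker_mul_card_range hstar hϖ hs
  rw [card_ker_eq_card_fixed hstar hϖ hs hnt] at hmul
  have hsq := card_fixed_sq_le hstar hϖ hs hnt
  have hF0 : 0 < Nat.card (fixedSet hstar hϖ hs) :=
    Nat.card_pos_iff.2 ⟨⟨⟨0, by show residueStar hstar hϖ hs 0 = 0; rw [map_zero]⟩⟩, inferInstance⟩
  -- `#𝔽₀ ≤ #range`
  have hle : Nat.card (fixedSet hstar hϖ hs) ≤ Nat.card (tracePlus hstar hϖ hs).range := by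
    rw [sq, ← hmul] at hsq
    exact Nat.le_of_mul_le_mul_left hsq hF0
  refine Set.eq_of_subset_of_ncard_le hsub ?_ (Set.toFinite _)
  rw [← Nat.card_coe_set_eq, ← Nat.card_coe_set_eq]
  exact hle

/-! ### The trace lift -/

omit [Finite (IsLocalRing.ResidueField R)] in
include hϖ in
/-- `1 + ϖ y` is a unit of `R`. -/
theorem isUnit_one_add_mul (y : R) : IsUnit (1 + ϖ * y) :=
  isUnit_of_add_irreducible_mul_eq_one hϖ (r₀ := 1 + ϖ * y) (y₀ := -y) (by ring)

/-- **The trace lift from the non-triviality of the residue involution**: `∃ e ∈ R, e + ē = 1`. -/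
theorem exists_trace_lift (hnt : ∃ t : IsLocalRing.ResidueField R, residueStar hstar hϖ hs t ≠ t) :
    ∃ e : R, algebraMap R E e + star (algebraMap R E e) = 1 := by
  -- a class `t` with `t + σ̄ t = 1`
  have h1 : (1 : IsLocalRing.ResidueField R) ∈ ((tracePlus hstar hϖ hs).range :
      Set (IsLocalRing.ResidueField R)) := by
    rw [range_tracePlus_eq_fixed hstar hϖ hs hnt]
    show residueStar hstar hϖ hs 1 = 1
    rw [map_one]
  obtain ⟨t, ht⟩ := h1
  obtain ⟨x, rfl⟩ := IsLocalRing.residue_surjective t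
  rw [tracePlus_apply, residueStar_residue, ← map_add, ← map_one (IsLocalRing.residue R),
    ← sub_eq_zero, ← map_sub, residue_eq_zero_iff_dvd hϖ] at ht
  obtain ⟨y, hy⟩ := ht
  -- `x + starR x = 1 + ϖ y` with `y` star-fixed, `v = 1 + ϖ y` a unit
  have hxy : x + starR hstar x = 1 + ϖ * y := by linear_combination hy
  have hy' : starR hstar y = y := by
    have h1 : ϖ * starR hstar y = ϖ * y := by
      have := congrArg (starR hstar) hxy
      rw [map_add, map_add, map_one, map_mul, starR_starR, starR_uniformiser hstar hs,
        add_comm (starR hstar x)] at this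
      linear_combination hxy - this
    exact mul_left_cancel₀ hϖ.ne_zero h1
  have hv : IsUnit (1 + ϖ * y) := isUnit_one_add_mul hϖ y
  refine ⟨x * ↑hv.unit⁻¹, ?_⟩
  have hv0 : algebraMap R E (1 + ϖ * y) ≠ 0 :=
    (map_ne_zero_iff _ (IsFractionRing.injective R E)).2 hv.ne_zero
  have hvs : star (algebraMap R E (1 + ϖ * y)) = algebraMap R E (1 + ϖ * y) := by
    rw [← algebraMap_starR hstar, map_add, map_one, map_mul, starR_uniformiser hstar hs, hy']
  have hinv : algebraMap R E (↑hv.unit⁻¹ : R) = (algebraMap R E (1 + ϖ * y))⁻¹ := by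
    rw [map_units_inv, IsUnit.unit_spec]
  rw [map_mul, hinv, star_mul, star_inv₀, hvs, ← algebraMap_starR hstar,
    mul_comm ((algebraMap R E (1 + ϖ * y))⁻¹), ← add_mul, ← map_add, hxy, mul_inv_cancel₀ hv0]

end TraceLift

end Summit.Ventures.HodgeRepro2.T5InertTraceLift
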